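import Summits.QuantumFields.BalabanUV.Gaps.D4WalkBlockLocalDecay
import Summits.QuantumFields.BalabanUV.T4Continuum.Spine.NE5.TwoRunPencilDomainsBlock

/-!
# Spine/NE5/TwoRunPencilDomainsBlockDecay — the (x4) pencil of domain-localised data with DECAYING blocks: `IsDomainLocalBD`
# along the pencil with `λ ↦ λ(1 + τr)` and the decay rate UNCHANGED (cell `pub-balaban-gaps`, seat `ne5` gen 7; the decaying
# twin of gen 6's `TwoRunPencilDomainsBlock`, over g1-p2 GEN 5's `Gaps/D4WalkBlockLocalDecay`)

Over g1-p2's `Gaps/D4WalkBlockLocalDecay.IsDomainLocalBD` (the third piece of print's one-scale walk bookkeeping: domain-localised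
families whose BLOCKS decay along the one-point distance, `‖F_b(u)‖_{y,y′} ≤ λ·e^{−ρD_b(y,y′)}` — [B9] (3.42) ∕ (3.89): the local
inverses and steps decay at the Combes–Thomas rate INSIDE their domains) and this seat's `TwoRunPencilDomains.withOp`: run A
`IsDomainLocalBD`, run B's coefficients (on run A's term index) block-supported in the same domains, entries holomorphic on the same
ball, BLOCK-close with the SAME DECAY `‖opB b u − op b u‖_{y,y′} ≤ r_AB·λ·e^{−ρD_b(y,y′)}` (the natural two-run currency for
decaying local inverses: the difference of two Combes–Thomas-decaying local inverses decays) ⟹ every pencil datum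
`withOp L (op + t(opB − op))`, `‖t‖ ≤ τ`, is `IsDomainLocalBD` with `λ(1 + τr_AB)` and the same `ρ`, every other letter unchanged
(`isDomainLocalBD_withOp_pencil`; reach form `_reach`) — so g1-p2's `blockWalkExpansion_domainLocalD` covers NE5's whole pencil
with one package and the walk rate stays the operator's OWN decay rate (no `e^{2ρr}`).  Standing offer (s7-a′) of `ne/NE5.md` §13.
HONEST FRAMING.  Bookkeeping (subadditivity ∕ homogeneity of the block norm); nothing of Bałaban's constructed; NE5 NOT PRINTED ∕ NOT
PROVED; (D4) 0∕1; 0∕12 leaves; words UNCHANGED; NOT continuum, NOT mass gap, NOT Clay.  0 sorry, 0 `def`.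
Sources: [B9] CMP **99** (1985) [Balaban1985BackgroundPropagators] (3.42) p. 397∕399, (3.87)–(3.89) p. 409, Thm 3.10 p. 416;
[II] CMP **116** (1988) [Balaban1988RG2Cluster] (1.5) p. 3, (1.11) p. 5, p. 15.
-/

noncomputable section

namespace Summit.QuantumFields.BalabanUV.T4Continuum.Spine.NE5.TwoRunPencilDomainsBlockDecay

open Metric Set Finset
open Literature.MathematicalPhysics.QuantumFieldTheory.Balaban1983to89
open Literature.MathematicalPhysics.QuantumFieldTheory.Balaban1983to89.B5TorusCover (UT)
open Literature.MathematicalPhysics.QuantumFieldTheory.Balaban1983to89.B13DomainKernelWalks (DomainTerms)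
open Summit.QuantumFields.BalabanUV.Gaps.D4WalkBlock (blockNorm blockNorm_nonneg blockNorm_add_le blockNorm_smul_le)
open Summit.QuantumFields.BalabanUV.Gaps.D4WalkBlockLocalDecay (IsDomainLocalBD)
open Summit.QuantumFields.BalabanUV.T4Continuum.Spine.NE5.TwoRunPencilDomains (withOp)
open Summit.QuantumFields.BalabanUV.T4Continuum.Spine.NE5.TwoRunPencilDomainsBlock (blockNorm_pencil_eq_zero)

variable {d N' : ℕ} {ν : ℕ} {K : Fin ν → ℕ} [∀ i, NeZero (K i)]
variable {p n : Type} [Fintype p] [Fintype n]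
variable {E : Type*} [NormedAddCommGroup E] [NormedSpace ℂ E]
variable {L : DomainTerms d N' ν K p n E}
variable {c : B13.Consts} {cub : p → UT K} {cubn : n → UT K} {X : Finset (UT K)} {R lam ρ r : ℝ} {mJ nD : ℕ}

/-- **`IsDomainLocalBD` ALONG THE PENCIL.**  Run A's decaying block datum (`λ`, rate `ρ`), run B's coefficients block-supported in the
same domains and holomorphic on the same ball, BLOCK-close WITH THE SAME DECAY `‖opB b u − op b u‖_{y,y′} ≤ r_AB·λ·e^{−ρD_b(y,y′)}`:
then for `‖t‖ ≤ τ` (so `τ ≥ 0` is automatic) the pencil datum `withOp L (op + t(opB − op))` is `IsDomainLocalBD` with `λ(1 + τr_AB)` and the same `ρ`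
(print's (1.5): *"operators … satisfying the same bounds"*; the decay rate is the operators' own, (3.42)∕(3.89)).
[cite: Balaban1988RG2Cluster, (1.5) p.3, p.15; Balaban1985BackgroundPropagators, (3.89) p.409, Thm 3.10 p.416] -/
theorem isDomainLocalBD_withOp_pencil (hL : IsDomainLocalBD L c cub cubn X R lam ρ r mJ nD)
    {opB : L.B → E → Matrix p n ℂ}
    (hsuppB : ∀ b u y y', blockNorm cub cubn (opB b u) y y' ≠ 0 → y ∈ L.dom b ∧ y' ∈ L.dom b)
    (hanB : ∀ b i j, DifferentiableOn ℂ (fun u => opB b u i j) (ball (0 : E) R))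
    {rAB τ : ℝ}
    (hdiffB : ∀ b, ∀ u ∈ ball (0 : E) R, ∀ y y',
      blockNorm cub cubn (opB b u - L.op b u) y y' ≤ rAB * (lam * Real.exp (-(ρ * L.dist X b y y'))))
    {t : ℂ} (ht : ‖t‖ ≤ τ) :
    IsDomainLocalBD (withOp L fun b u => L.op b u + t • (opB b u - L.op b u)) c cub cubn X R ((1 + τ * rAB) * lam) ρ r mJ nD
    where
  hanchor := hL.hanchor
  hsuppB b u y y' hne := by
    by_contra hout
    have hA : blockNorm cub cubn (L.op b u) y y' = 0 := by
      by_contra h; exact hout (hL.hsuppB b u y y' h)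
    have hB : blockNorm cub cubn (opB b u) y y' = 0 := by
      by_contra h; exact hout (hsuppB b u y y' h)
    exact hne (blockNorm_pencil_eq_zero t hA hB)
  han b i j := by
    show DifferentiableOn ℂ (fun u => (L.op b u + t • (opB b u - L.op b u)) i j) (ball (0 : E) R)
    simp only [Matrix.add_apply, Matrix.smul_apply, Matrix.sub_apply, smul_eq_mul]
    exact (hL.han b i j).add (((hanB b i j).sub (hL.han b i j)).const_mul t)
  hbdBD b u hu y y' := by
    show blockNorm cub cubn (L.op b u + t • (opB b u - L.op b u)) y y' ≤
      (1 + τ * rAB) * lam * Real.exp (-(ρ * (withOp L fun b u => L.op b u + t • (opB b u - L.op b u)).dist X b y y'))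
    have hdist : (withOp L fun b u => L.op b u + t • (opB b u - L.op b u)).dist X b y y' = L.dist X b y y' := rfl
    rw [hdist]
    set m := lam * Real.exp (-(ρ * L.dist X b y y')) with hm
    have hm0 : 0 ≤ blockNorm cub cubn (opB b u - L.op b u) y y' := blockNorm_nonneg cub cubn _ y y'
    calc blockNorm cub cubn (L.op b u + t • (opB b u - L.op b u)) y y'
        ≤ blockNorm cub cubn (L.op b u) y y' + blockNorm cub cubn (t • (opB b u - L.op b u)) y y' :=
          blockNorm_add_le cub cubn _ _ y y'
      _ ≤ m + ‖t‖ * blockNorm cub cubn (opB b u - L.op b u) y y' :=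
          add_le_add (hL.hbdBD b u hu y y') (blockNorm_smul_le cub cubn t _ y y')
      _ ≤ m + τ * (rAB * m) := add_le_add_right (mul_le_mul ht (hdiffB b u hu y y') hm0 ((norm_nonneg t).trans ht)) m
      _ = (1 + τ * rAB) * lam * Real.exp (-(ρ * L.dist X b y y')) := by rw [hm]; ring
  hdiam := hL.hdiam
  hJ := hL.hJ
  hX := hL.hX
  hmult := hL.hmult

/-- **Reach form**: with `t` up to `s ∕ r_AB` (`r_AB > 0`) the letter is `(1 + s)·λ`, free of the two-run rate, the decay
rate `ρ` untouched. [cite: Balaban1988RG2Cluster, (1.5) p.3, (2.16) p.16] -/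
theorem isDomainLocalBD_withOp_pencil_reach (hL : IsDomainLocalBD L c cub cubn X R lam ρ r mJ nD)
    {opB : L.B → E → Matrix p n ℂ}
    (hsuppB : ∀ b u y y', blockNorm cub cubn (opB b u) y y' ≠ 0 → y ∈ L.dom b ∧ y' ∈ L.dom b)
    (hanB : ∀ b i j, DifferentiableOn ℂ (fun u => opB b u i j) (ball (0 : E) R))
    {rAB s : ℝ} (hr : 0 < rAB)
    (hdiffB : ∀ b, ∀ u ∈ ball (0 : E) R, ∀ y y',
      blockNorm cub cubn (opB b u - L.op b u) y y' ≤ rAB * (lam * Real.exp (-(ρ * L.dist X b y y'))))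
    {t : ℂ} (ht : ‖t‖ ≤ s / rAB) :
    IsDomainLocalBD (withOp L fun b u => L.op b u + t • (opB b u - L.op b u)) c cub cubn X R ((1 + s) * lam) ρ r mJ nD := by
  have hsr : 1 + s / rAB * rAB = 1 + s := by rw [div_mul_cancel₀ s hr.ne']
  simpa only [hsr] using isDomainLocalBD_withOp_pencil hL hsuppB hanB hdiffB ht

/-- **Run B itself** (`t = 1`, `τ = 1`): block-closeness with decay at rate `r_AB` makes run B's datum `IsDomainLocalBD` with
`λ(1 + r_AB)` — the two runs and every pencil member are in ONE decaying class. [cite: Balaban1988RG2Cluster, (1.5) p.3] -/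
theorem isDomainLocalBD_withOp_runB (hL : IsDomainLocalBD L c cub cubn X R lam ρ r mJ nD)
    {opB : L.B → E → Matrix p n ℂ}
    (hsuppB : ∀ b u y y', blockNorm cub cubn (opB b u) y y' ≠ 0 → y ∈ L.dom b ∧ y' ∈ L.dom b)
    (hanB : ∀ b i j, DifferentiableOn ℂ (fun u => opB b u i j) (ball (0 : E) R)) {rAB : ℝ}
    (hdiffB : ∀ b, ∀ u ∈ ball (0 : E) R, ∀ y y',
      blockNorm cub cubn (opB b u - L.op b u) y y' ≤ rAB * (lam * Real.exp (-(ρ * L.dist X b y y')))) :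
    IsDomainLocalBD (withOp L fun b u => L.op b u + (1 : ℂ) • (opB b u - L.op b u)) c cub cubn X R ((1 + 1 * rAB) * lam) ρ r
      mJ nD :=
  isDomainLocalBD_withOp_pencil hL hsuppB hanB hdiffB (t := 1) (τ := 1) (by simp)

end Summit.QuantumFields.BalabanUV.T4Continuum.Spine.NE5.TwoRunPencilDomainsBlockDecay

end
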